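import Summits.BirchSwinnertonDyer.BirchSwinnertonDyer.Theorems.EisensteinPrimesMazurMCOnCellBKernelCertP13NoUnitVertex
import Summits.BirchSwinnertonDyer.BirchSwinnertonDyer.Theorems.EisensteinPrimesMazurMCOnCellBTwistbackOrderOneAnchorZigzag
import Summits.BirchSwinnertonDyer.BirchSwinnertonDyer.Theorems.SchneiderFreeAdditiveX3PoitouTateSelmerDualityHolds
import Summits.BirchSwinnertonDyer.BirchSwinnertonDyer.Theorems.SchneiderFreeAdditiveX3PoitouTateShaDualityHolds
import HarnessLib

/-!
# Crux 3 `MazurMCOnCellB` (stmt-BirchSwinnertonDyer-19033) — the first A10-type cell at `p = 13` (`t = −19/13 ⊗ χ₋₄₂`, `N = 504 452 265 408`, `[13², 13²]`):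
# the cell's SECOND typed exit — twistback 6⁷'s RIGHT disjunct at distance 0, road (b) AT `E` itself (`E` is NON-split at `13`)

Width seat bsd-line-x2-p1-w6 (gen 19), cell `bsd-eis`, 2026-08-29; `--supports stmt-BirchSwinnertonDyer-19033 --as helper`. THEOREMS ONLY. Companion of
`…KernelCertP13NoUnitVertex` (p745174), which certifies the class in the kernel (§1–§3), records under the readings `shaAn E = shaAn E′ = 13²` that the distance-`0`
Ш-unit witness of 6⁷'s LEFT disjunct fails at both vertices, and instantiates the LEFT disjunct's remaining offer (a CONNECTED Ш-unit class at distance `≥ 1`,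
x2-p1-w3 g14's zig-zag door). THIS file instantiates the RIGHT disjunct's cheapest offer for this cell: because `E` is NON-split multiplicative at `13`
(`nonsplit13_e13a10`, kernel), LEAD g15's road-(b) anchor door `…TwistbackOrderOneAnchorZigzag.mazurMainConjectureAt_of_cellB_of_isIsogenous_orderOneAnchor`
applies with the anchor `W₀ := E` in `W`'s own isogeny class: ONE admissible imaginary quadratic `K₀` (Heegner for `N` and for `13`, `d_{K₀}` odd `< −4`) whose
non-split `13`-adic `L`-function of `E^{(d_{K₀})}` has `ord_{T=0} = 1` (x2-p1-w3 g11's certificate currency `hordL`, p661229) gives Mazur's main conjecture at `13`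
at every globally minimal `W ∼ E` — over the PUB cone + Disegni 2020 (`padicBSD_rankOne_nonsplitMult`, `padicGrossZagier_nonsplitMult`) + Mazur 1978 + Hsieh 2014 +
Liu–Zhang–Zhang 2018 + Keller–Yin Thm. D (PREPRINT), with the two Poitou–Tate inputs DISCHARGED by the tree theorems of `SchneiderFreeAdditiveX3.PoitouTateReduction`
(as in twistback v13b's `poitouTate_pair`) and `X2.CellB` at `W` from the rank reading `hr` AT `E`. So the cell's two exits are, by name: (L) a Ш-unit class connected
to `E`'s class at distance `≥ 1` (`…NoUnitVertex.mazurMainConjectureAt_of_isIsogenous_e13a10_of_connectedClassShaUnit`; nearest candidates `N > 10¹⁵`), or (R, this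
file) ONE order-one `13`-adic certificate at ONE admissible `K₀` for `E` — a finite `13`-adic computation on an explicit curve, kit-sized, NOT performed here.

HONEST FRAMING: CONDITIONAL display; the certificate `hordL` and the field `K₀` are hypotheses, NOT exhibited; nothing booked; closes no registered stub; 0 cells /
labels / stubs / tiers move; no summit statement, no case of Mazur's main conjecture and no case of BSD is proved for any curve. References: [Disegni2020] §2.2 Thm. 2.4
and §3.2 Thm. 4; [PerrinRiou1987] §1.4; [KellerYin2024] Thm. D; [Wuthrich2014] Thm. 16; [MilneADT2006] Thm. I.7.3; memo `P13-DESCENT-A10HUNT-w6g19.md` (evidence #43 on -19033).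
-/

set_option autoImplicit false
-- `Summit.BirchSwinnertonDyer.BirchSwinnertonDyer.…`: the summit and its single sub-problem share a name.
set_option linter.dupNamespace false

noncomputable section

open scoped Classical MatrixGroups ModularForm
open CongruenceSubgroup WeierstrassCurve NumberField
  Literature.NumberTheory.EllipticCurves
  Literature.NumberTheory.GaloisRepresentations
  Literature.NumberTheory.EllipticCurves.ModularForms
  Literature.NumberTheory.QuadraticFields
  Literature.NumberTheory.EllipticCurves.Rank1Residual
  Literature.NumberTheory.EllipticCurves.Rank1Residual.Typed
  Literature.NumberTheory.EllipticCurves.Wuthrich2014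
  Literature.NumberTheory.EllipticCurves.Disegni2020
  Literature.NumberTheory.EllipticCurves.KellerYin2024
  Literature.NumberTheory.GaloisCohomology
  Summit.BirchSwinnertonDyer.Rank1Residual
  Summit.BirchSwinnertonDyer.Rank1Residual.X2
  Summit.BirchSwinnertonDyer.BirchSwinnertonDyer.Theses
  Summit.BirchSwinnertonDyer.BirchSwinnertonDyer.Theorems
  Summit.BirchSwinnertonDyer.BirchSwinnertonDyer.Theorems.EisensteinPrimesMazurMCOnCellBTwistbackTwoStepDefs
  Summit.BirchSwinnertonDyer.BirchSwinnertonDyer.Theorems.EisensteinPrimesMazurMCOnCellBKernelCertP13NoUnitVertex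

namespace Summit.BirchSwinnertonDyer.BirchSwinnertonDyer.Theorems.EisensteinPrimesMazurMCOnCellBKernelCertP13NoUnitVertexAnchor

/-- **6⁷'s RIGHT disjunct at distance `0` for the first A10-type cell at `13` — road (b) AT `E = [0,0,0,55547317476,58239761976082638]` itself.** For every globally
minimal `W ∼ E`: the PUB cone, Disegni 2020 (non-split `13`-adic BSD in rank one and `13`-adic Gross–Zagier), Mazur 1978, Hsieh 2014, LZZ 2018, Keller–Yin Thm. D, the rank
reading `hr` at `E`, and ONE admissible `K₀` for `E` with the order-one certificate `hordL` give `X2.MazurMainConjectureAt W 13`. The anchor's non-split sign is the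
kernel fact `nonsplit13_e13a10`; the Poitou–Tate inputs are the tree theorems of `SchneiderFreeAdditiveX3.PoitouTateReduction`. CONDITIONAL; `K₀` NOT exhibited.
[claim: KellerYin2024, status: under-review] [cite: KellerYin2024, Thm. D = Thm. 5.1.3] [cite: Disegni2020, §2.2 Thm. 2.4 and §3.2 Thm. 4]
[cite: MilneADT2006, Thm. I.7.3] [cite: Wuthrich2014, Thm. 16 (p. 397)] -/
theorem mazurMainConjectureAt_of_isIsogenous_e13a10_of_orderOneAnchor_self [Fact (Nat.Prime 13)] (hP : EisensteinPrimes.PublishedInputs)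
    (hH : hsieh2014_exists_anticyclotomicPAdicLFunction)
    (hF : LiuZhangZhang2018.thm151_thm153_modularCurve_heegnerVector) (hMaz : mazur_not_dvd_maninConstant_of_odd)
    (hDis : padicBSD_rankOne_nonsplitMult) (hDGZ : padicGrossZagier_nonsplitMult)
    (hD : KellerYin2024.thmD_imcMult_exists_isBDPLFunction_isTorsion_charIdeal_eq_OPEN)
    (hr : (⟨0, 0, 0, 55547317476, 58239761976082638⟩ : WeierstrassCurve ℚ).analyticRank = 0)
    (W : WeierstrassCurve ℚ) [W.IsElliptic] [W.IsGloballyMinimal] (hiso : IsIsogenous (⟨0, 0, 0, 55547317476, 58239761976082638⟩ : WeierstrassCurve ℚ) W)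
    (K₀ : Type) [Field K₀] [NumberField K₀] (hK : IsImaginaryQuadratic K₀)
    (hHN : SatisfiesHeegnerHypothesis ((⟨0, 0, 0, 55547317476, 58239761976082638⟩ : WeierstrassCurve ℚ).conductorNorm ℤ) K₀)
    (hHp : SatisfiesHeegnerHypothesis 13 K₀) (hodd : Odd (NumberField.discr K₀)) (hlt : NumberField.discr K₀ < -4)
    (hordL : ∀ (Wd : WeierstrassCurve ℚ) [Wd.IsElliptic] [Wd.IsGloballyMinimal],
      (∃ C : VariableChange ℚ, C • Wd = (⟨0, 0, 0, 55547317476, 58239761976082638⟩ : WeierstrassCurve ℚ).quadraticTwist (NumberField.discr K₀ : ℚ)) →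
      ∀ {M : ℕ} [NeZero M] (f : CuspForm (Gamma0 M) 2), IsNewformOf Wd f →
      ∀ (ϖ : ℚ), (ϖ : ℝ) * Wd.realPeriodRat = plusPeriod f →
      ∀ L : PowerSeries ℚ_[13], IsMultPAdicLFunctionOf f 13 (-1) L → L.order = ((1 : ℕ) : ℕ∞)) :
    X2.MazurMainConjectureAt W 13 := by
  haveI := isElliptic_e13a10; haveI := isGloballyMinimal_e13a10
  have hcW : X2.CellB W 13 :=
    (EisensteinPrimesMazurMCOnCellBTwistbackIsogenyTransport.cellB_iff_of_isIsogenous hiso).mp (cellB_e13a10_of_analyticRank hr)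
  exact EisensteinPrimesMazurMCOnCellBTwistbackOrderOneAnchorZigzag.mazurMainConjectureAt_of_cellB_of_isIsogenous_orderOneAnchor hP
    (fun K _ _ ↦ SchneiderFreeAdditiveX3.PoitouTateReduction.poitouTate_selmerStructure_duality_holds K)
    (fun K _ _ ↦ SchneiderFreeAdditiveX3.PoitouTateReduction.poitouTate_sha_tateDual_holds K)
    hH hF hMaz hDis hDGZ hD W 13 hcW (⟨0, 0, 0, 55547317476, 58239761976082638⟩ : WeierstrassCurve ℚ) hiso.symm_of_charZero
    nonsplit13_e13a10 K₀ hK hHN hHp hodd hlt hordL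

end Summit.BirchSwinnertonDyer.BirchSwinnertonDyer.Theorems.EisensteinPrimesMazurMCOnCellBKernelCertP13NoUnitVertexAnchor
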